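import Literature.MathematicalPhysics.QuantumFieldTheory.Balaban1983to89.B9Thm39FibreReadoutAtLettersY

/-!
# `Balaban1983to89.B9Thm39RopReadoutAtLettersY` — (3.95)'s REMAINDER `R` of rows 15–16's walk AT def-Y's `𝔸`-LEVEL LETTERS: the operator `RopBlk (cubeOps39YF …)`
# of the (3.96) Neumann series IS `realify39` of the `𝔸`-level remainder `ropA39` (the three sums of (3.95) spelled with `XY`, `GsqY`, `dirPadY`, the
# cut-offs), so the schema `Small285Blk` ([4] (2.83)–(2.85)) follows from an `𝔸`-level fibre-kernel bound on `ropA39` — the second of rows 15–16's two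
# local analytic inputs as an `𝔸`-level target

statement-level skeleton of published theorems with citation tags; proofs where landed; nothing here is a claim about the
Yang–Mills mass gap

T. Bałaban, *Propagators for lattice gauge theories in a background field*, Commun. Math. Phys. **99** (1985) 389–434
[`Balaban1985BackgroundPropagators`, "[B9]"]; [4] = T. Bałaban, *Propagators and renormalization transformations for lattice gauge theories. II*,
Commun. Math. Phys. **96** (1984) 223–250 [`Balaban1984PropagatorsII`].  PDF held (`paper:balaban1985-cmp99-background-propagators`, journal page = PDF
page + 388); p. 411 re-read by this seat (2026-08-28); [4] (2.83)–(2.85) p. 238 as quoted in this lineage's `B9Thm39WholeBlk`.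

THE PRINT (verbatim, p. 411).  *«Q′G′²Q′\*C₀ = I + Σ_□(1 − □̃)Q′G′²Q′\*h_□C_□h_□ + Σ_□ □̃Q′(G′² − G′_□²)Q′\*h_□C_□h_□ + Σ_□[□̃Q′G′_□²Q′\*, h_□]C_□h_□ = I − R (3.95). By the
same estimates as in [4], especially (2.83)–(2.85), we can see that the operator R is small and (Q′G′²Q′\*)⁻¹ = C₀(I − R)⁻¹ = Σ_{n=0}^∞ C₀Rⁿ (3.96).»*

WHY THIS FILE (cell context, pub-ymgap N06 DAG).  After `B9Thm39CubeOpsAtLettersY` ∕ `…CubeOpsWalkDataY` (this lineage, g20) the certificate's rows-15–16 binder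
`h348` follows from two LOCAL schemas at the genuine instance, `Local348Blk` and `Small285Blk`; `B9Thm39FibreReadoutAtLettersY` made the first an `𝔸`-level
fibre-kernel statement.  This file does the same for the second: the X39-level remainder `RopBlk (cubeOps39YF 𝔏 bI 𝒞 x) U` (this lineage's g0 spelling of (3.95)'s
`R` on real coordinates) is IDENTIFIED with `realify39 basis39 (ropA39 …)`, `ropA39` being the same three sums written with def-Y's `𝔸`-linear letters — `realify39`
is additive, multiplicative, unital and carries real cut-offs to `mulOp` — so `Small285Blk` follows from one `𝔸`-level fibre-kernel bound `‖(R f)(s)‖ ≤ Σ K(s,s′)‖f(s′)‖`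
with `K(s, s′) ≤ C·M⁻¹·e^{−(δ₁/2)d(s,s′)}` ([4] (2.85)'s shape), by the general read-out with the constant weight `M⁻¹`.

WHAT IS DEFINED ∕ PROVED (sorry-free; ONE definition with body, `ropA39` — the `𝔸`-level remainder; no estimate asserted).
* §1 `realify39` is a homomorphism of real algebras onto its image: `realify39_add ∕ _neg ∕ _sub ∕ _sum`, ★ `realify39_cutMulY` (a real cut-off reads as `mulOp (h ∘ fst)`).
* §2 ★ `ropA39 i parS Gp D Dblk hB U` (def): (3.95)'s `R` at the `𝔸`-level letters — `−(Σ_c (1 − M_{χ_c})·uX·(M_{h_c}C_cM_{h_c}) + Σ_c M_{χ_c}·(uX − uX_c^pad)·(M_{h_c}C_cM_{h_c})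
  + Σ_c (M_{χ_c}·uX_c^pad·M_{h_c} − M_{h_c}·(M_{χ_c}·uX_c^pad))·C_c·M_{h_c})`, `u = unit39`, `X = XY i parS Gp U`, `X_c^pad = dirPadY (M_{χ_c}) (XY i parS (GsqY i parS (D c)) U)`,
  `C_c = Ring.inverse (u • X_c^pad)`, `χ_c = 𝟙_{Dblk c}`; ★★ `ropBlk_cubeOps39YF_eq_realify39` — `RopBlk (cubeOps39YF 𝔏 bI 𝒞 x) U = realify39 basis39 (ropA39 …)` whenever every
  `u • X_c^pad` is a unit (always, at `parSymY`).
* §3 ★★★ `small285Blk_cubeOps39YF_of_fibreKernel` — `Small285Blk (cubeOps39YF 𝔏 bI 𝒞 x) (cR39·C·c_L·e^{δ₁/2}) (δ₁/4) U` from a fibre-kernel bound on `ropA39` with shape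
  `K(s, s′) ≤ C·M⁻¹·e^{−(δ₁/2)d(s,s′)}` (+ `hβ1`, the torus row sum, the unit hypotheses).

HONEST SCOPE.  Currency bookkeeping only: [4] (2.83)–(2.85) ∕ [B9] (3.96)'s «R is small» is the analytic content and stays the HYPOTHESIS (at the local
operators: Theorem 3.1-type bounds for `G′`, `G′_□`, the cube geometry `|∇h_□| ≲ (ML^jη)⁻¹`, and Theorem 3.2 for `C_□`); nothing of it is proved or asserted.
`𝔸 = M_N(ℂ)` at the instance.  Count-neutral (no new named fact; N06 NOT discharged); nothing continuum, nothing about OS axioms or the mass gap.  No `sorry`,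
no `axiom`, no `instance`, no `notation`.  Seat `pub-ymgap-dag-n06-j` (bundle F5, rows 15–17), gen 20, 2026-08-28; NEW file; modifies nothing.
-/

noncomputable section

namespace Literature.MathematicalPhysics.QuantumFieldTheory.Balaban1983to89.B9Thm39RopReadoutAtLettersY

open Finset B6RandomWalk B9Thm37Sum B9Thm39WholeBlk B9Thm39ReadingCoords B9Thm39ReadingAtLetters B9Thm39OneCubeReadingAtLettersY B9Thm39CubeOpsAtLettersY
  B9Thm39FibreReadoutAtLettersY B9Thm311LocalInversePosY Node00 Node00.OpsYLocalInverse
open B9Thm37CubeCoverCommutators (cutMulY cutMulY_apply)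
open B6KLevelCensusIndexV1 B6Geom246MultiLevelBox B6Geom246MultiLevelTorus B6Ineq2142KLevelV1 B6GlobalChartV1 B6Ineq288MultiLevelTorus
  B9Ineq349SiteComposite B9Ineq349SiteFromBlocks B9Ineq349SiteFromConv348 B9PinMembersKLevelV1 B9PinCarriersKLevelV1 B9PinGeometryKLevelV1 B7Prop2SpecialUnitary
open scoped Matrix

/-! ## §1 `realify39` is additive and carries real cut-offs to `mulOp` -/

section Realify

variable {𝔸 : Type} [NormedRing 𝔸] [NormedAlgebra ℂ 𝔸]
variable {S κ : Type} [Fintype κ]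

/-- `realify39` is additive. [cite: Balaban1985BackgroundPropagators, p.389, dictionary] -/
theorem realify39_add (b : Module.Basis κ ℝ 𝔸) (O O' : (S → 𝔸) →ₗ[ℂ] (S → 𝔸)) :
    realify39 b (O + O') = realify39 b O + realify39 b O' := by
  apply LinearMap.ext; intro f
  simp only [LinearMap.add_apply, realify39_apply, map_add]

/-- `realify39` commutes with negation. [cite: Balaban1985BackgroundPropagators, p.389, dictionary] -/
theorem realify39_neg (b : Module.Basis κ ℝ 𝔸) (O : (S → 𝔸) →ₗ[ℂ] (S → 𝔸)) : realify39 b (-O) = -realify39 b O := by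
  apply LinearMap.ext; intro f
  simp only [LinearMap.neg_apply, realify39_apply, map_neg]

/-- `realify39` is subtractive. [cite: Balaban1985BackgroundPropagators, p.389, dictionary] -/
theorem realify39_sub (b : Module.Basis κ ℝ 𝔸) (O O' : (S → 𝔸) →ₗ[ℂ] (S → 𝔸)) :
    realify39 b (O - O') = realify39 b O - realify39 b O' := by
  rw [sub_eq_add_neg, realify39_add, realify39_neg, ← sub_eq_add_neg]

/-- `realify39` commutes with finite sums. [cite: Balaban1985BackgroundPropagators, p.389, dictionary] -/
theorem realify39_sum {ι : Type} (b : Module.Basis κ ℝ 𝔸) (s : Finset ι) (O : ι → (S → 𝔸) →ₗ[ℂ] (S → 𝔸)) :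
    realify39 b (∑ c ∈ s, O c) = ∑ c ∈ s, realify39 b (O c) := by
  classical
  induction s using Finset.induction_on with
  | empty =>
      rw [Finset.sum_empty, Finset.sum_empty]
      apply LinearMap.ext; intro f
      simp only [realify39_apply, LinearMap.zero_apply, map_zero]
  | insert c s hc ih => rw [Finset.sum_insert hc, Finset.sum_insert hc, realify39_add, ih]

/-- ★ a REAL CUT-OFF reads, in real coordinates, as the multiplier by `h ∘ fst`: `realify39 b (M_h) = mulOp (fun p => h p.1)`.
[cite: Balaban1985BackgroundPropagators, (3.87) p.409 (the cut-offs h_□), dictionary] -/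
theorem realify39_cutMulY (b : Module.Basis κ ℝ 𝔸) (h : S → ℝ) :
    realify39 b (cutMulY h) = mulOp (fun p : S × κ => h p.1) := by
  apply LinearMap.ext; intro f
  funext p
  rw [realify39_apply, coordEquiv39_symm_apply, mulOp_apply, cutMulY_apply, Complex.coe_smul, map_smul, Finsupp.smul_apply, smul_eq_mul,
    ← coordEquiv39_symm_apply, LinearEquiv.symm_apply_apply]

end Realify

/-! ## §2 The `𝔸`-level remainder of (3.95) at the instance's letters, and its identification with `RopBlk (cubeOps39YF …)` -/

section Rop

open scoped Matrix.Norms.L2Operator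

variable {d ℓ : ℕ} {hd : 1 ≤ d + 1} {hL : Odd (ℓ + 1) ∧ 1 < ℓ + 1} {b₀ b₁ : ℝ} {N : ℕ}

/-- ★ **(3.95)'s REMAINDER `R` AT THE `𝔸`-LEVEL LETTERS** (this lineage's g0 spelling `B9Thm39WholeBlk.RopBlk`, letter for letter): with `u = unit39`,
`X = XY i parS Gp U` (the global `Q′G′²Q′\*`), `X_c^pad = M_{χ_c}·Q′G′_□²Q′\*(U)·M_{χ_c} + 1 − M_{χ_c}` (`χ_c = 𝟙_{Dblk c}`, `G′_□ = GsqY … (D c)`), `C_c = (u•X_c^pad)⁻¹`: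
`R = −(Σ_c (1 − M_{χ_c})·uX·(M_{h_c}C_cM_{h_c}) + Σ_c M_{χ_c}·(uX − uX_c^pad)·(M_{h_c}C_cM_{h_c}) + Σ_c (M_{χ_c}·uX_c^pad·M_{h_c} − M_{h_c}·(M_{χ_c}·uX_c^pad))·C_c·M_{h_c})`.
[cite: Balaban1985BackgroundPropagators, (3.95) p.411; Balaban1984PropagatorsII, (2.82) p.237] -/
def ropA39 (i : KIdx d ℓ hd hL b₀ b₁) {ι : Type} [Fintype ι] (parS : SiteParY (Matrix (Fin N) (Fin N) ℂ) i) (Gp : SiteOpY (Matrix (Fin N) (Fin N) ℂ) i)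
    (D : ι → Finset (SiteY i)) (Dblk : ι → Finset (BlkY i)) (hB : ι → BlkY i → ℝ) (U : CfgY (Matrix (Fin N) (Fin N) ℂ) i) :
    Module.End ℂ (BlkY i → Matrix (Fin N) (Fin N) ℂ) :=
  -(∑ c, (1 - cutMulY (blkIndY i (Dblk c))) * (((unit39 i : ℝ) : ℂ) • XY i parS Gp U) *
        (cutMulY (hB c) * Ring.inverse (((unit39 i : ℝ) : ℂ) • dirPadY (cutMulY (blkIndY i (Dblk c))) (XY i parS (GsqY i parS (D c)) U)) * cutMulY (hB c)) +
      ∑ c, cutMulY (blkIndY i (Dblk c)) * ((((unit39 i : ℝ) : ℂ) • XY i parS Gp U) - (((unit39 i : ℝ) : ℂ) • dirPadY (cutMulY (blkIndY i (Dblk c))) (XY i parS (GsqY i parS (D c)) U))) *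
        (cutMulY (hB c) * Ring.inverse (((unit39 i : ℝ) : ℂ) • dirPadY (cutMulY (blkIndY i (Dblk c))) (XY i parS (GsqY i parS (D c)) U)) * cutMulY (hB c)) +
      ∑ c, (cutMulY (blkIndY i (Dblk c)) * (((unit39 i : ℝ) : ℂ) • dirPadY (cutMulY (blkIndY i (Dblk c))) (XY i parS (GsqY i parS (D c)) U)) * cutMulY (hB c)
          - cutMulY (hB c) * (cutMulY (blkIndY i (Dblk c)) * (((unit39 i : ℝ) : ℂ) • dirPadY (cutMulY (blkIndY i (Dblk c))) (XY i parS (GsqY i parS (D c)) U)))) *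
        Ring.inverse (((unit39 i : ℝ) : ℂ) • dirPadY (cutMulY (blkIndY i (Dblk c))) (XY i parS (GsqY i parS (D c)) U)) * cutMulY (hB c))

variable {θ : Stage3Params} {Mstar : ℕ} (𝔏 : LettersY N θ Mstar)
variable [∀ x : MemberY θ.d₆ θ.ℓ₆ θ.hd' θ.hL' θ.b₀ θ.b₁ Mstar, Fintype (geo9Y x).Site]
  [∀ x : MemberY θ.d₆ θ.ℓ₆ θ.hd' θ.hL' θ.b₀ θ.b₁ Mstar, DecidableEq (geo9Y x).Site]
variable (bI : ∀ x : MemberY θ.d₆ θ.ℓ₆ θ.hd' θ.hL' θ.b₀ θ.b₁ Mstar, FBondY x.toKIdx → IBondY x.toKIdx)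
variable {ι : MemberY θ.d₆ θ.ℓ₆ θ.hd' θ.hL' θ.b₀ θ.b₁ Mstar → Type} [∀ x, Fintype (ι x)] (𝒞 : ∀ x, CubeData39 θ Mstar (ι x) x)

omit [∀ x : MemberY θ.d₆ θ.ℓ₆ θ.hd' θ.hL' θ.b₀ θ.b₁ Mstar, Fintype (geo9Y x).Site]
  [∀ x : MemberY θ.d₆ θ.ℓ₆ θ.hd' θ.hL' θ.b₀ θ.b₁ Mstar, DecidableEq (geo9Y x).Site] in
/-- ★★ **THE X39-LEVEL REMAINDER IS THE `𝔸`-LEVEL ONE READ THROUGH THE CHART**: `RopBlk (cubeOps39YF 𝔏 bI 𝒞 x) U = realify39 basis39 (ropA39 …)` whenever every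
`u • X_c^pad` is a unit (so that `C_□ = realify39 (u • X_c^pad)⁻¹`, `ringInverse_realify39`). [cite: Balaban1985BackgroundPropagators, (3.95) p.411; Balaban1984PropagatorsII, (2.82) p.237] -/
theorem ropBlk_cubeOps39YF_eq_realify39 (x : MemberY θ.d₆ θ.ℓ₆ θ.hd' θ.hL' θ.b₀ θ.b₁ Mstar)
    (U : (bg9Y (Matrix (Fin N) (Fin N) ℂ) (specialUnitaryUnits (Fin N)) x).Cfg)
    (hU : ∀ c, IsUnit ((((unit39 x.toKIdx : ℝ) : ℂ)) •
      dirPadY (cutMulY (blkIndY x.toKIdx ((𝒞 x).Dblk c))) (XY x.toKIdx (𝔏 x).parS (GsqY x.toKIdx (𝔏 x).parS ((𝒞 x).D c)) U))) :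
    RopBlk (cubeOps39YF 𝔏 bI 𝒞 x) U
      = realify39 (basis39 (Matrix (Fin N) (Fin N) ℂ)) (ropA39 x.toKIdx (𝔏 x).parS (𝔏 x).Gp (𝒞 x).D (𝒞 x).Dblk (𝒞 x).hB U) := by
  have hCl : ∀ c, (cubeOps39YF 𝔏 bI 𝒞 x).Cl U c = realify39 (basis39 (Matrix (Fin N) (Fin N) ℂ)) (Ring.inverse ((((unit39 x.toKIdx : ℝ) : ℂ)) •
      dirPadY (cutMulY (blkIndY x.toKIdx ((𝒞 x).Dblk c))) (XY x.toKIdx (𝔏 x).parS (GsqY x.toKIdx (𝔏 x).parS ((𝒞 x).D c)) U))) := fun c => by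
    rw [cubeOps39YF_Cl, Cl39, Lloc39, ringInverse_realify39 _ (hU c)]
  have hLloc : ∀ c, (cubeOps39YF 𝔏 bI 𝒞 x).Lloc U c = realify39 (basis39 (Matrix (Fin N) (Fin N) ℂ)) ((((unit39 x.toKIdx : ℝ) : ℂ)) •
      dirPadY (cutMulY (blkIndY x.toKIdx ((𝒞 x).Dblk c))) (XY x.toKIdx (𝔏 x).parS (GsqY x.toKIdx (𝔏 x).parS ((𝒞 x).D c)) U)) := fun c => rfl
  have hL : (cubeOps39YF 𝔏 bI 𝒞 x).L U = realify39 (basis39 (Matrix (Fin N) (Fin N) ℂ)) ((((unit39 x.toKIdx : ℝ) : ℂ)) • XY x.toKIdx (𝔏 x).parS (𝔏 x).Gp U) := rfl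
  have hh : ∀ c, mulOp ((cubeOps39YF 𝔏 bI 𝒞 x).h c) = realify39 (basis39 (Matrix (Fin N) (Fin N) ℂ)) (cutMulY ((𝒞 x).hB c)) := fun c => by
    rw [realify39_cutMulY]; rfl
  have hchi : ∀ c, mulOp ((cubeOps39YF 𝔏 bI 𝒞 x).chi c) = realify39 (basis39 (Matrix (Fin N) (Fin N) ℂ)) (cutMulY (blkIndY x.toKIdx ((𝒞 x).Dblk c))) := fun c => by
    rw [realify39_cutMulY]; rfl
  simp only [RopBlk, hCl, hLloc, hL, hh, hchi, ropA39, realify39_neg, realify39_add, realify39_sum, realify39_mul, realify39_sub, realify39_one]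

end Rop

/-! ## §3 `Small285Blk` at the instance from an `𝔸`-level fibre-kernel bound on `ropA39` -/

section Small

open scoped Matrix.Norms.L2Operator

variable {N : ℕ} {θ : Stage3Params} {Mstar : ℕ} (𝔏 : LettersY N θ Mstar)
variable [∀ x : MemberY θ.d₆ θ.ℓ₆ θ.hd' θ.hL' θ.b₀ θ.b₁ Mstar, Fintype (geo9Y x).Site]
  [∀ x : MemberY θ.d₆ θ.ℓ₆ θ.hd' θ.hL' θ.b₀ θ.b₁ Mstar, DecidableEq (geo9Y x).Site]
variable (bI : ∀ x : MemberY θ.d₆ θ.ℓ₆ θ.hd' θ.hL' θ.b₀ θ.b₁ Mstar, FBondY x.toKIdx → IBondY x.toKIdx)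
variable {ι : MemberY θ.d₆ θ.ℓ₆ θ.hd' θ.hL' θ.b₀ θ.b₁ Mstar → Type} [∀ x, Fintype (ι x)] (𝒞 : ∀ x, CubeData39 θ Mstar (ι x) x)

omit [∀ x : MemberY θ.d₆ θ.ℓ₆ θ.hd' θ.hL' θ.b₀ θ.b₁ Mstar, DecidableEq (geo9Y x).Site] in
/-- ★★★ **ROWS 15–16's SECOND LOCAL SCHEMA FROM AN `𝔸`-LEVEL FIBRE-KERNEL BOUND**: at a member with a 1-faithful `bI`, if the `𝔸`-level remainder `R = ropA39 …` of
(3.95) obeys `‖(R f)(s)‖ ≤ Σ_{s′} K(s, s′)‖f(s′)‖` with `K(s, s′) ≤ C·M⁻¹·e^{−(δ₁/2)d(s,s′)}` ([4] (2.85)'s shape at the covariant letters) and the torus row sum is `≤ c_L`,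
then `Small285Blk (cubeOps39YF 𝔏 bI 𝒞 x) (cR39·C·c_L·e^{δ₁/2}) (δ₁/4) U` (given the unit property of the local letters, automatic at `parSymY`).
[cite: Balaban1985BackgroundPropagators, (3.95)–(3.96) p.411; Balaban1984PropagatorsII, (2.83)–(2.85) p.238, (2.51) p.232, (2.61) p.234] -/
theorem small285Blk_cubeOps39YF_of_fibreKernel (x : MemberY θ.d₆ θ.ℓ₆ θ.hd' θ.hL' θ.b₀ θ.b₁ Mstar)
    (hβ1 : ∀ f : FBondY x.toKIdx, (geomT x.D).dist (β x.hN x.D x.hk (bI x f)) (blkV1 x.hN x.D f) ≤ 1)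
    (U : (bg9Y (Matrix (Fin N) (Fin N) ℂ) (specialUnitaryUnits (Fin N)) x).Cfg) {C δ₁ cL : ℝ} (hC : 0 ≤ C) (hδ₁ : 0 ≤ δ₁) (hcL : 0 ≤ cL)
    (hMpos : 0 < (geo9Y x).M)
    (hrow : ∀ y : BlkY x.toKIdx, ∑ y' : BlkY x.toKIdx, Real.exp (-(1 / 2 * (δ₁ / 2) * distB x.toKIdx y y')) ≤ cL)
    (hU : ∀ c, IsUnit ((((unit39 x.toKIdx : ℝ) : ℂ)) •
      dirPadY (cutMulY (blkIndY x.toKIdx ((𝒞 x).Dblk c))) (XY x.toKIdx (𝔏 x).parS (GsqY x.toKIdx (𝔏 x).parS ((𝒞 x).D c)) U)))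
    (K : BlkY x.toKIdx → BlkY x.toKIdx → ℝ) (hK0 : ∀ s s', 0 ≤ K s s')
    (hK : ∀ (f : BlkY x.toKIdx → Matrix (Fin N) (Fin N) ℂ) (s : BlkY x.toKIdx),
      ‖ropA39 x.toKIdx (𝔏 x).parS (𝔏 x).Gp (𝒞 x).D (𝒞 x).Dblk (𝒞 x).hB U f s‖ ≤ ∑ s', K s s' * ‖f s'‖)
    (hshape : ∀ s s' : BlkY x.toKIdx, K s s' ≤ C * ((geo9Y x).M)⁻¹ * Real.exp (-(δ₁ / 2 * distB x.toKIdx s s'))) :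
    Small285Blk (cubeOps39YF 𝔏 bI 𝒞 x) (cR39 (basis39 (Matrix (Fin N) (Fin N) ℂ)) * C * cL * Real.exp (δ₁ / 2)) (δ₁ / 4) U where
  rk := by
    have h1 : ropA39 x.toKIdx (𝔏 x).parS (𝔏 x).Gp (𝒞 x).D (𝒞 x).Dblk (𝒞 x).hB U
        = (((1 : ℝ) : ℂ)) • ropA39 x.toKIdx (𝔏 x).parS (𝔏 x).Gp (𝒞 x).D (𝒞 x).Dblk (𝒞 x).hB U := by
      rw [Complex.ofReal_one, one_smul]
    have hmaj := hasMajorant_realify39_of_fibreKernel_F (𝔸 := Matrix (Fin N) (Fin N) ℂ) x hβ1 (O := ropA39 x.toKIdx (𝔏 x).parS (𝔏 x).Gp (𝒞 x).D (𝒞 x).Dblk (𝒞 x).hB U)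
      (r := 1) (W := fun _ => ((geo9Y x).M)⁻¹) (fun _ => inv_nonneg.2 hMpos.le) hC hδ₁ hcL hK0 hK
      (fun s s' => by rw [abs_one, one_mul]; exact hshape s s') hrow
    show HasMajorant (g := b6 (geo9Y x)) (blk39F (Matrix (Fin N) (Fin N) ℂ) x.toKIdx (bI x)) (RopBlk (cubeOps39YF 𝔏 bI 𝒞 x) U) _
    rw [ropBlk_cubeOps39YF_eq_realify39 𝔏 bI 𝒞 x U hU, h1]
    exact hmaj

end Small

end Literature.MathematicalPhysics.QuantumFieldTheory.Balaban1983to89.B9Thm39RopReadoutAtLettersY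

end
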